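import Literature.IUT.HodgeTheaters.PuncturedEllipticProLModelGeomLaws
import Literature.IUT.HodgeTheaters.PuncturedEllipticCoveringsOpenProofs
import HarnessLib

/-!
# An infinite pro-`l` model of [IUTchI] §1, part 6: the abelian subgroup `Π_X̲ = N ⋊ ⟨a^l⟩`, (L0), (L1), (L4)

Mochizuki, *Inter-universal Teichmüller theory I*, kurims manuscript (May 2020), §1 pp. 37–38 — the `Δ_ε`-level
sentences typed by abc-iut-L5-t1 as the record `PuncturedEllipticData.ModLCuspLaws` (p446054: fields (L0) (L1)
(L2a) (L2c) (L3) (L4)) ([IUTchI] §1 p.37) [claim: Mochizuki2012, status: disputed] (D-0012 claim key; series status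
DISPUTED — WITNESS-class PROOF-ONLY module; nothing of the series is asserted, no side is taken on [IUTchIII] Cor. 3.12).

At the pro-`l` datum `ProLModel.datum l h5` of abc-iut-L5-d4 (parts 1–5): the subgroup `Π_X̲ = Δ_X̲ = Π_X ∩ Π_C̲`
is `N ⋊ ⟨a^l⟩ = N × lℤ_l` — ABELIAN (`a^l` acts trivially on `N`) — and:
* `toDih_surjective` — `D ↠ D_l` (the prose of part 1 made a theorem; reader's note of abc-iut-w6-d067);
* `mem_PiXbar_iff`, `commute_of_mem_PiXbar`, `left_mul_of_mem_PiXbar` — the structure of `Π_X̲`;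
* `deltaXbar_eq`, `deltaCbar_eq`, `inertia_eq` — the §1 vocabulary of the datum unfolded;
* **(L4) `inertia_central_datum`** — `Π_X̲` centralises every cusp inertia group (the commutator IS `1`);
* **(L0) `modLKer_relIndex_ne_zero_datum`** — from `GeomTFG`-style finite generation (abc-iut-L5-t2/t7's
  `modLKer_relIndex_ne_zero_of_tfg`, p424558, BY NAME; `Π_X̲` is open in the compact `Π_C`);
* **(L1) `inertia_procyclic_datum`** — `I_i = ℤ_l · c_i` is the closure of `⟨c_i⟩`;
* `inN_sub_sum_mem_of_cvec_mem` — every `(u)` with `Σ_m u_m = 0` lies in any subgroup containing the inertia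
  LINES `ℤ_l · c_x`, `x ≠ 0` (telescoping `B_0 − B_{−j} = c_{−1} + ⋯ + c_{−j}`), the combinatorial core of (L2a)/(L3);
* `conj_elA_of_not_mem_PiXm` — `ι`-class elements invert `⟨a⟩`: `c · a^s · c⁻¹ = a^{−s}` (`s ≡ 0 mod l`).
(L2a), (L2c), (L3) and the assembled `ModLCuspLaws` are the sequel.  HONEST LABEL: semi-synthetic model (`G_k = 1`)
— consistency evidence for OUR typed binders / the `Δ_X̲`-abelian shadow; no `sorry`; symbolic prime `l`.
-/

noncomputable section

namespace Literature.IUT.HodgeTheaters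

namespace PuncturedEllipticData

namespace ProLModel

open DihedralGroup _root_.Topology Literature.AnabelianGeometry.AbsoluteAnabelian
open scoped Pointwise

variable (l : ℕ) [Fact l.Prime]

/-- `inN (−w) = (inN w)⁻¹`. [claim: Mochizuki2012, status: disputed] -/
theorem inN_neg (w : V l) : inN l (-w) = (inN l w)⁻¹ := by
  rw [← zero_sub, inN_sub, inN_zero, one_mul]

/-! ### `D ↠ D_l` -/

/-- **`toDih : D ↠ D_l` is surjective** (`r_k ↦` the lift `(k̃, 1)`, `s r_k ↦ (−k̃, ι)`).
[claim: Mochizuki2012, status: disputed] -/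
theorem toDih_surjective : Function.Surjective (toDih l) := by
  intro d
  cases d with
  | r k =>
    refine ⟨SemidirectProduct.inl (Multiplicative.ofAdd ((k.val : ℕ) : ℤ_[l])), ?_⟩
    rw [toDih_apply, SemidirectProduct.left_inl, SemidirectProduct.right_inl, toAdd_ofAdd, map_natCast,
      ZMod.natCast_zmod_val, expo_one, pow_zero, mul_one]
  | sr k =>
    refine ⟨SemidirectProduct.inl (Multiplicative.ofAdd (((-k).val : ℕ) : ℤ_[l])) *
      SemidirectProduct.inr (Multiplicative.ofAdd 1), ?_⟩
    rw [map_mul, toDih_apply, toDih_apply, SemidirectProduct.left_inl, SemidirectProduct.right_inl,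
      SemidirectProduct.left_inr, SemidirectProduct.right_inr, toAdd_ofAdd, map_natCast, ZMod.natCast_zmod_val,
      expo_one, pow_zero, mul_one, toAdd_one, map_zero, r_zero, one_mul]
    have h1 : expo (Multiplicative.ofAdd (1 : ZMod 2)) = 1 := rfl
    rw [h1, pow_one, r_mul_sr, zero_sub, neg_neg]

/-! ### The subgroup `Π_X̲ = Π_X ∩ Π_C̲` -/

/-- `g ∈ Π_X̲` iff its `ℤ/2`-component is trivial and its `⟨a⟩`-exponent is `≡ 0 (mod l)`.
[claim: Mochizuki2012, status: disputed] -/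
theorem mem_PiXbar_iff (g : P l) : g ∈ PiXm l ⊓ PiCbarm l ↔
    g.right.right = 1 ∧ PadicInt.toZMod (Multiplicative.toAdd g.right.left) = 0 := by
  constructor
  · rintro ⟨hX, hC⟩
    refine ⟨(mem_PiXm_iff l g).1 hX, ?_⟩
    have h := toDih_right_of_mem_PiXbar l hX hC
    rw [toDih_right_of_mem_PiXm l hX, one_def] at h
    exact r.inj h
  · rintro ⟨h1, h2⟩
    have hX : g ∈ PiXm l := (mem_PiXm_iff l g).2 h1
    exact ⟨hX, Or.inl (by rw [toDihP_apply, toDih_right_of_mem_PiXm l hX, h2, r_zero])⟩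

/-- On `Π_X̲` the action on `N` is trivial: `φ_{g.right} = 1`. [claim: Mochizuki2012, status: disputed] -/
theorem phi_right_eq_one_of_mem_PiXbar {g : P l} (hg : g ∈ PiXm l ⊓ PiCbarm l) : phi l g.right = 1 := by
  change (phiD l) (toDih l g.right) = 1
  rw [toDih_right_of_mem_PiXbar l hg.1 hg.2, map_one]

/-- On `Π_X̲` the `N`-parts multiply. [claim: Mochizuki2012, status: disputed] -/
theorem left_mul_of_mem_PiXbar {g : P l} (hg : g ∈ PiXm l ⊓ PiCbarm l) (h : P l) :
    (g * h).left = g.left * h.left := by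
  rw [SemidirectProduct.mul_left, phi_right_eq_one_of_mem_PiXbar l hg, MulAut.one_apply]

/-- **`Π_X̲` is abelian.** [claim: Mochizuki2012, status: disputed] -/
theorem commute_of_mem_PiXbar {g h : P l} (hg : g ∈ PiXm l ⊓ PiCbarm l) (hh : h ∈ PiXm l ⊓ PiCbarm l) :
    g * h = h * g := by
  have hg1 := ((mem_PiXbar_iff l g).1 hg).1
  have hh1 := ((mem_PiXbar_iff l h).1 hh).1
  obtain ⟨x, hx⟩ : ∃ x : C l, g.right = SemidirectProduct.inl x := ⟨_, SemidirectProduct.ext rfl hg1⟩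
  obtain ⟨y, hy⟩ : ∃ y : C l, h.right = SemidirectProduct.inl y := ⟨_, SemidirectProduct.ext rfl hh1⟩
  refine SemidirectProduct.ext ?_ ?_
  · rw [left_mul_of_mem_PiXbar l hg, left_mul_of_mem_PiXbar l hh, mul_comm]
  · rw [SemidirectProduct.mul_right, SemidirectProduct.mul_right, hx, hy, ← map_mul, ← map_mul, mul_comm]

/-- `a^s` with `s ≡ 0 (mod l)` lies in `Π_X̲`. [claim: Mochizuki2012, status: disputed] -/
theorem elA_mem_PiXbar {s : ℤ_[l]} (hs : PadicInt.toZMod s = 0) : elA l s ∈ PiXm l ⊓ PiCbarm l :=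
  (mem_PiXbar_iff l _).2 ⟨rfl, hs⟩

/-- `(v) ∈ Π_X̲`. [claim: Mochizuki2012, status: disputed] -/
theorem inN_mem_PiXbar (v : V l) : inN l v ∈ PiXm l ⊓ PiCbarm l := Nhat_le l (inN_mem_Nhat l v)

/-- Powers in `Π_X̲`: `((v)·a^s)^n = (n·v)·a^{n s}` for `s ≡ 0 (mod l)`. [claim: Mochizuki2012, status: disputed] -/
theorem inN_mul_elA_pow {s : ℤ_[l]} (hs : PadicInt.toZMod s = 0) (v : V l) (n : ℕ) :
    (inN l v * elA l s) ^ n = inN l ((n : ℤ_[l]) • v) * elA l ((n : ℤ_[l]) * s) := by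
  induction n with
  | zero => rw [pow_zero, Nat.cast_zero, zero_smul, zero_mul, inN_zero, one_mul]; rfl
  | succ n ih =>
    rw [pow_succ, ih, Nat.cast_succ, add_smul, one_smul, add_mul, one_mul, inN_add, elA_add]
    have hc : elA l ((n : ℤ_[l]) * s) * inN l v = inN l v * elA l ((n : ℤ_[l]) * s) :=
      commute_of_mem_PiXbar l (elA_mem_PiXbar l (by rw [map_mul, hs, mul_zero])) (inN_mem_PiXbar l v)
    rw [mul_assoc, ← mul_assoc (elA l _), hc, mul_assoc, ← mul_assoc]

/-! ### The §1 vocabulary of the datum, unfolded -/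

/-- `Δ_X̲ = Π_X̲` at the datum (`G_k = 1`). [claim: Mochizuki2012, status: disputed] -/
theorem deltaXbar_eq (h5 : 5 ≤ l) : (datum l h5).DeltaXbar = PiXm l ⊓ PiCbarm l := by
  change (PiXm l ⊓ PiCbarm l) ⊓ (ext l).geom = PiXm l ⊓ PiCbarm l
  rw [geom_eq_top, inf_top_eq]

/-- `Δ_C̲ = Π_C̲` at the datum. [claim: Mochizuki2012, status: disputed] -/
theorem deltaCbar_eq (h5 : 5 ≤ l) : (datum l h5).DeltaCbar = PiCbarm l := by
  change PiCbarm l ⊓ (ext l).geom = PiCbarm l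
  rw [geom_eq_top, inf_top_eq]

/-- `I_x = D_x = ℤ_l · c_x` at the datum. [claim: Mochizuki2012, status: disputed] -/
theorem inertia_eq (h5 : 5 ≤ l) (x : ZMod l) : (datum l h5).inertia x = Dm l x := by
  change Dm l x ⊓ (ext l).geom = Dm l x
  rw [geom_eq_top, inf_top_eq]

/-- `D_x ≤ Π_X̲`. [claim: Mochizuki2012, status: disputed] -/
theorem Dm_le_PiXbar (x : ZMod l) : Dm l x ≤ PiXm l ⊓ PiCbarm l := (Dm_le_Nhat l x).trans (Nhat_le l)

/-! ### (L4), (L0), (L1) at the datum -/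

/-- **(L4) at the pro-`l` datum**: `Π_X̲` acts trivially on every cusp inertia group (modulo anything — the commutator
is `1`, `Π_X̲` being abelian). ([IUTchI] §1 p.38) [claim: Mochizuki2012, status: disputed] -/
theorem inertia_central_datum (h5 : 5 ≤ l) : ∀ x : (datum l h5).Cusp, ∀ g ∈ (datum l h5).PiXbar,
    ∀ z ∈ (datum l h5).inertia x, g * z * g⁻¹ * z⁻¹ ∈ (datum l h5).modLKer := by
  intro x g hg z hz
  rw [inertia_eq] at hz
  have hcomm := commute_of_mem_PiXbar l hg (Dm_le_PiXbar l x hz)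
  rw [hcomm, mul_inv_cancel_right, mul_inv_cancel]
  exact Subgroup.one_mem _

/-- **(L0) at the pro-`l` datum**: `[Δ_X̲ : Ker(Δ_X̲ ↠ Δ_X̲^{ab} ⊗ ℤ/l)] ≠ 0` (abc-iut-L5-t2/t7's
`modLKer_relIndex_ne_zero_of_tfg` BY NAME: `Δ_X̲` is open in the topologically finitely generated compact `Π_C`).
([IUTchI] §1 p.37) [claim: Mochizuki2012, status: disputed] -/
theorem modLKer_relIndex_ne_zero_datum (h5 : 5 ≤ l) :
    (datum l h5).modLKer.relIndex (datum l h5).DeltaXbar ≠ 0 := by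
  refine (datum l h5).modLKer_relIndex_ne_zero_of_tfg ?_
  rw [deltaXbar_eq]
  have hP : IsTopologicallyFinitelyGenerated (P l) := ⟨exists_generators l⟩
  exact hP.subgroup_isOpen _ ((isOpen_PiXm l).inter (isOpen_PiCbarm l))

/-- **(L1) at the pro-`l` datum**: every cusp inertia group is procyclic — `I_x = ℤ_l · c_x = ⟨(c_x)⟩⁻`.
([IUTchI] §1 p.37) [claim: Mochizuki2012, status: disputed] -/
theorem inertia_procyclic_datum (h5 : 5 ≤ l) : ∀ x : (datum l h5).Cusp, ∃ z ∈ (datum l h5).inertia x,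
    (datum l h5).inertia x ≤ (Subgroup.zpowers z).topologicalClosure := by
  intro x
  rw [inertia_eq]
  refine ⟨inN l (cvec l x), ⟨Multiplicative.ofAdd 1, by rw [inertiaHom_apply, toAdd_ofAdd, one_smul]⟩, ?_⟩
  rintro _ ⟨s, rfl⟩
  rw [inertiaHom_apply]
  exact inN_smul_mem_of_isClosed l _ (Subgroup.isClosed_topologicalClosure _) _
    (Subgroup.le_topologicalClosure _ (Subgroup.mem_zpowers _)) _

/-! ### Sum-zero vectors lie in the span of the inertia lines `ℤ_l · c_x`, `x ≠ 0` -/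

/-- `1 ≤ j < l ⇒ (j : ℤ/l) ≠ 0` (and hence `−j ≠ 0`). [claim: Mochizuki2012, status: disputed] -/
theorem neg_natCast_ne_zero {j : ℕ} (hj0 : 0 < j) (hjl : j < l) : -((j : ZMod l)) ≠ 0 := by
  rw [neg_ne_zero]
  exact ArrowModel.natCast_ne_zero_of_lt l hj0 hjl

/-- Telescoping: `(t·(B_0 − B_{−j}))` lies in any subgroup containing the lines `ℤ_l · c_x` for `x ≠ 0`
(`B_0 − B_{−j} = c_{−1} + ⋯ + c_{−j}`, `1 ≤ j ≤ l − 1`). [claim: Mochizuki2012, status: disputed] -/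
theorem inN_smul_δ_sub_mem (S : Subgroup (P l)) (hS : ∀ x : ZMod l, x ≠ 0 → ∀ t : ℤ_[l], inN l (t • cvec l x) ∈ S)
    (t : ℤ_[l]) : ∀ j : ℕ, j < l → inN l (t • (δ l 0 - δ l (-(j : ZMod l)))) ∈ S := by
  intro j
  induction j with
  | zero => intro _; rw [Nat.cast_zero, neg_zero, sub_self, smul_zero, inN_zero]; exact S.one_mem
  | succ j ih =>
    intro hj
    have hstep : δ l 0 - δ l (-((j + 1 : ℕ) : ZMod l)) =
        (δ l 0 - δ l (-(j : ZMod l))) + cvec l (-((j + 1 : ℕ) : ZMod l)) := by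
      unfold cvec; push_cast
      have : -((j : ZMod l) + 1) + 1 = -(j : ZMod l) := by ring
      rw [this]; abel
    rw [hstep, smul_add, inN_add]
    exact S.mul_mem (ih (by omega)) (hS _ (neg_natCast_ne_zero l (Nat.succ_pos j) hj) t)

/-- **Every `(u)` corrected by its coordinate sum lies in the span of the inertia lines `ℤ_l·c_x`, `x ≠ 0`:**
`(u − (Σ_m u_m)·B_0) ∈ S` whenever `S ⊇ ℤ_l · c_x` for all `x ≠ 0`. [claim: Mochizuki2012, status: disputed] -/
theorem inN_sub_sum_mem_of_cvec_mem (S : Subgroup (P l))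
    (hS : ∀ x : ZMod l, x ≠ 0 → ∀ t : ℤ_[l], inN l (t • cvec l x) ∈ S) (u : V l) :
    inN l (u - (∑ m, u m) • δ l 0) ∈ S := by
  classical
  haveI : NeZero l := ⟨(Fact.out : l.Prime).ne_zero⟩
  induction u using Pi.single_induction with
  | zero => simp only [Pi.zero_apply, Finset.sum_const_zero, zero_smul, sub_zero, inN_zero]; exact S.one_mem
  | add f g hf hg =>
    have : f + g - (∑ m, (f + g) m) • δ l 0 = (f - (∑ m, f m) • δ l 0) + (g - (∑ m, g m) • δ l 0) := by
      simp only [Pi.add_apply, Finset.sum_add_distrib, add_smul]; abel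
    rw [this, inN_add]
    exact S.mul_mem hf hg
  | single i t =>
    have hsum : ∑ m, (Pi.single i t : V l) m = t := by
      rw [Finset.sum_eq_single i (fun m _ hm => Pi.single_eq_of_ne hm _)
        (fun h => absurd (Finset.mem_univ i) h), Pi.single_eq_same]
    have hj : (-(((-i).val : ℕ) : ZMod l)) = i := by rw [ZMod.natCast_zmod_val, neg_neg]
    have hrw : (Pi.single i t : V l) - t • δ l 0 = -(t • (δ l 0 - δ l i)) := by
      funext m
      simp only [Pi.sub_apply, Pi.neg_apply, Pi.smul_apply, δ_apply, Pi.single_apply, smul_eq_mul, mul_sub,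
        mul_ite, mul_one, mul_zero]
      ring
    rw [hsum, hrw, inN_neg]
    refine S.inv_mem ?_
    have h := inN_smul_δ_sub_mem l S hS t ((-i).val) (ZMod.val_lt _)
    rwa [hj] at h

/-! ### `ι`-class elements invert `⟨a⟩` -/

/-- For `c ∉ Π_X` (an `ι`-class element) and `s ≡ 0 (mod l)`: `c · a^s · c⁻¹ = a^{−s}`.
[claim: Mochizuki2012, status: disputed] -/
theorem conj_elA_of_not_mem_PiXm {c : P l} (hcX : c ∉ PiXm l) {s : ℤ_[l]} (hs : PadicInt.toZMod s = 0) :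
    c * elA l s * c⁻¹ = elA l (-s) := by
  have hcι : expo c.right.right = 1 := by
    have hc1 : c.right.right ≠ 1 := fun h => hcX ((mem_PiXm_iff l c).2 h)
    have ht : expo c.right.right < 2 := (Multiplicative.toAdd c.right.right).val_lt
    interval_cases h : expo c.right.right
    · exact absurd (toAdd_eq_zero.mp ((ZMod.val_eq_zero _).1 h)) hc1
    · rfl
  have hc : c = SemidirectProduct.inl c.left * SemidirectProduct.inr c.right :=
    (SemidirectProduct.inl_left_mul_inr_right c).symm
  have h1 : (SemidirectProduct.inr c.right : P l) * elA l s * (SemidirectProduct.inr c.right)⁻¹ = elA l (-s) := by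
    unfold elA
    rw [← map_inv, ← map_mul, ← map_mul, D_conj_inl, psi_apply, if_neg (by rw [hcι]; exact one_ne_zero),
      ← ofAdd_neg]
  have h2 : (SemidirectProduct.inl c.left : P l) * elA l (-s) = elA l (-s) * SemidirectProduct.inl c.left :=
    commute_of_mem_PiXbar l (inN_mem_PiXbar l (Multiplicative.toAdd c.left))
      (elA_mem_PiXbar l (by rw [map_neg, hs, neg_zero]))
  calc c * elA l s * c⁻¹
      = SemidirectProduct.inl c.left * ((SemidirectProduct.inr c.right : P l) * elA l s *
          (SemidirectProduct.inr c.right)⁻¹) * (SemidirectProduct.inl c.left)⁻¹ := by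
        conv_lhs => rw [hc]
        simp only [mul_inv_rev, mul_assoc]
    _ = SemidirectProduct.inl c.left * elA l (-s) * (SemidirectProduct.inl c.left)⁻¹ := by rw [h1]
    _ = elA l (-s) := by rw [h2, mul_inv_cancel_right]

end ProLModel

end PuncturedEllipticData

end Literature.IUT.HodgeTheaters
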